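import Summits.HodgeConjecture.HodgeConjecture.Theorems.Ring2AbelianAllAndreFibreClassInvariantDuality
import Summits.HodgeConjecture.HodgeConjecture.Theorems.AmpleAdicLefschetzThickDescentGysinZeroCup
import HarnessLib

/-!
# Ring 2 · sub-cell AbelianAll (ALL ABELIAN VARIETIES), André axis, part XXVI-a — `range j_{t*} = j_{t*}(Im j_t^*)` and
# `Hᵃ(X_t) = Im j_t^* ⊕ ker j_{t*}` for EVERY smooth projective family over a smooth projective base

HONEST FRAMING (page 1, verbatim): **research route, not a corollary; conditional on HC_CM plus one named
minimal statement.** Cell line: research route conditional on HC_CM; not a corollary; Q11.4-sentence-2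
already refuted in dim ≥ 3. Nothing in this file proves a case of the Hodge conjecture for an abelian variety; `HC_CM` does not occur
in it; item `Theses.RankFourFaces.CMToAbelian` (stmt-16267) OPEN and not closed here. Seat `pub-hodge-ring2-ab-andre-2`, gen 18;
brief (iii) "attack `B_min`: what is known".

## What this file proves (theorems only; no definition, no named fact, no sorry)

Part XXV-f left displayed, inside the bracket `CMThetaInv[]`, ONE `ν`-free clause: (surjInv) "every Gysin image `j_{s*} x` of a
class of a fibre `X_s` of a compact abelian pencil is the Gysin image `j_{s*}(j_s^* y)` of an INVARIANT class" (print: Deligne's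
semisimplicity). This file PROVES it for EVERY smooth projective family `f : 𝒳 ⟶ S` of relative dimension `n` over a smooth
projective base `S` of any dimension `m` (`𝒳` smooth projective of dimension `N = n + m`), in all degrees, on the carriers
(`j_t = fiberι f t`, `j_t^* = complexBetti.map`, `j_{t*} = complexGysin complexOrientationFamily`):

* §1 `finrank_range_le_of_pairing` — linear algebra (one-sided twin of part XIV-g's `finrank_range_eq_of_perfect`): a pairing
  `B : V₂ × V₁ → K` killing `ker j₂` on the left with `(∀ a, B a w = 0) → j₁ w = 0` forces `dim j₁(V₁) ≤ dim j₂(V₂)`.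
* §2 **`finrank_range_map_fiberι_eq_of_add`** `dim j_t^* Hᵃ(𝒳) = dim j_t^* H^{a'}(𝒳)` for `a + a' = 2n` (the pairing
  `⟨j_t^* W ∪ j_t^* A, [X_t]⟩` is perfect modulo the kernels: transposition `⟨j_{t*} x ∪ z, [𝒳]⟩ = ⟨x ∪ j_t^* z, [X_t]⟩`
  (`Theorems.cupPairing_complexGysin_complexOrientationFamily`), Poincaré duality on `𝒳(ℂ)` (`isPerfPair_cupPairing_of_field_holds`)
  and Deligne's `ker j_{t*} ∩ Im j_t^* = 0` (`deligne1971_fibreGysin_injOn_restricted_holds`, part XII-e) — part XIV-g §2 in all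
  degrees and over any base); **`finrank_range_complexGysin_fiberι_le`** `rank j_{t*}|Hᵃ(X_t) ≤ dim j_t^* H^{a'}(𝒳)` (the functional
  `z ↦ ⟨j_{t*} x ∪ z, [𝒳]⟩` determines `j_{t*} x` and factors through `j_t^*`); `injective_complexGysin_comp_subtype_range`;
  **`range_complexGysin_fiberι_eq_map_range`: `range j_{t*} = j_{t*}(Im j_t^*)`** (`⊇` trivially; dimensions:
  `dim j_{t*}(Im j_t^*) = dim Im j_t^*|ₐ = dim Im j_t^*|_{a'} ≥ rank j_{t*}`); **`exists_complexGysin_fiberι_eq_complexGysin_map`**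
  (the `∃` form = (surjInv) verbatim); `finrank_range_complexGysin_fiberι_eq` (`rank j_{t*} = dim Im j_t^*`);
  **`isCompl_range_map_fiberι_ker_complexGysin`: `Hᵃ(X_t) = j_t^* Hᵃ(𝒳) ⊕ ker j_{t*}`** — the invariant / co-vanishing
  decomposition of the cohomology of a fibre of a smooth projective family with NO singular fibre over a projective base.

In print: `Im j_t^* = Hᵃ(X_t)^π` (global invariant cycles, Deligne 4.1.1 / Voisin II Thm. 4.24), `j_{t*}` is the Poincaré transpose
of `j_t^*`, and the Poincaré pairing of `X_t` is non-degenerate on the invariants (Deligne's semisimplicity / polarisation argument)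
— here replaced by the tree theorem `ker j_{t*} ∩ Im j_t^* = 0` and a dimension count. Consumers: part XXVI-b (the weights of the
André axis from the abelian-scheme structure alone).

## Honest status

No node is born; nothing is minimal; nothing here is progress on `HC_AV` by itself: these are unconditional structure theorems on
the cohomology of smooth projective families, used by part XXVI-b to discharge the clause (surjInv) of part XXV-f.

References: DeligneHodgeII1971 (Thm. 4.1.1, Thm. 4.2.6, Cor. 4.2.8); VoisinHodgeII2003 (§4.3.1 Thm. 4.18, §4.3.3 Thm. 4.24);
FultonYoungTableaux1997 (App. B (5)–(6)); HatcherAT2002 (§3.3 Prop. 3.38).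
-/

noncomputable section

set_option linter.dupNamespace false

namespace Summit.HodgeConjecture.HodgeConjecture.Ring2.AbelianAll

open CategoryTheory AlgebraicGeometry
open Literature.AlgebraicGeometry Literature.AlgebraicGeometry.Motives
open Literature.AlgebraicGeometry.HodgeTheory
open Literature.AlgebraicTopology.SingularHomology (singularCohomology cupProduct cupPairing cupPairing_apply
  cupProduct_gradedComm_holds isPerfPair_cupPairing_of_field_holds)
open Summit.HodgeConjecture.HodgeConjecture.Theorems (cupPairing_complexGysin_complexOrientationFamily)

/-! ## §1 Linear algebra: a pairing killing one kernel and detecting the other bounds the rank -/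

/-- **Rank bound from a one-sided pairing.** For linear `j₁ : V₁ → U₁`, `j₂ : V₂ → U₂` (`V₁`, `V₂` finite-dimensional) and a
bilinear `B : V₂ × V₁ → K` with `B a · = 0` whenever `j₂ a = 0` and `j₁ w = 0` whenever `B · w = 0`: `dim j₁(V₁) ≤ dim j₂(V₂)`
(`w ↦ B(·, w)` maps `V₁` to the dual of `V₂ / ker j₂` with kernel inside `ker j₁`). One-sided twin of part XIV-g's
`finrank_range_eq_of_perfect`. [folklore] -/
theorem finrank_range_le_of_pairing {K V₁ V₂ U₁ U₂ : Type*} [Field K]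
    [AddCommGroup V₁] [Module K V₁] [FiniteDimensional K V₁] [AddCommGroup V₂] [Module K V₂]
    [FiniteDimensional K V₂] [AddCommGroup U₁] [Module K U₁] [AddCommGroup U₂] [Module K U₂]
    (j₁ : V₁ →ₗ[K] U₁) (j₂ : V₂ →ₗ[K] U₂) (B : V₂ →ₗ[K] V₁ →ₗ[K] K)
    (hB₁ : ∀ a, j₂ a = 0 → ∀ w, B a w = 0) (hB₄ : ∀ w, (∀ a, B a w = 0) → j₁ w = 0) :
    Module.finrank K (LinearMap.range j₁) ≤ Module.finrank K (LinearMap.range j₂) := by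
  classical
  have hk : LinearMap.ker j₂ ≤ LinearMap.ker B := fun a ha ↦ by
    rw [LinearMap.mem_ker]
    ext w
    exact hB₁ a (LinearMap.mem_ker.1 ha) w
  set B₁ : (V₂ ⧸ LinearMap.ker j₂) →ₗ[K] V₁ →ₗ[K] K := (LinearMap.ker j₂).liftQ B hk with hB₁def
  have hB₁_mk : ∀ a w, B₁ (Submodule.Quotient.mk a) w = B a w := fun a w ↦ rfl
  -- `ker (w ↦ B₁(·, w)) ≤ ker j₁`
  have hker : LinearMap.ker B₁.flip ≤ LinearMap.ker j₁ := fun w hw ↦ by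
    rw [LinearMap.mem_ker] at hw ⊢
    refine hB₄ w fun a ↦ ?_
    rw [← hB₁_mk, ← LinearMap.flip_apply, hw, LinearMap.zero_apply]
  have h1 := LinearMap.finrank_range_add_finrank_ker j₁
  have h2 := LinearMap.finrank_range_add_finrank_ker B₁.flip
  have h3 := Submodule.finrank_mono hker
  have h4 : Module.finrank K (LinearMap.range B₁.flip) ≤ Module.finrank K (V₂ ⧸ LinearMap.ker j₂) :=
    (Submodule.finrank_le _).trans (le_of_eq Subspace.dual_finrank_eq)
  rw [← (LinearMap.quotKerEquivRange j₂).finrank_eq]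
  omega

/-! ## §2 `range j_{t*} = j_{t*}(Im j_t^*)` for every smooth projective family over a smooth projective base -/

section Family

variable {𝒳 S : SchemeOver ℂ} {n m N : ℕ} {f : 𝒳 ⟶ S}

/-- **Complementary invariant parts have the same dimension, all degrees, any base.** For a smooth projective family
`f : 𝒳 ⟶ S` of relative dimension `n` over a smooth projective `S` (dimension `m`), `𝒳` smooth projective of dimension `N`,
a point `t` and `a + a' = 2n`: `dim j_t^* Hᵃ(𝒳(ℂ); ℂ) = dim j_t^* H^{a'}(𝒳(ℂ); ℂ)` — the pairing `(A, W) ↦ ⟨j_t^* W ∪ j_t^* A, [X_t(ℂ)]⟩`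
on `H^{a'}(𝒳) × Hᵃ(𝒳)` kills both kernels and is non-degenerate modulo them: `⟨j_t^* A ∪ j_t^* W, [X_t]⟩ = ⟨j_{t*} j_t^* A ∪ W, [𝒳]⟩`
for all `W` forces `j_{t*} j_t^* A = 0` (Poincaré duality on `𝒳(ℂ)`), hence `j_t^* A = 0` (Deligne). Part XIV-g §2 in every degree.
[cite: DeligneHodgeII1971, Thm. 4.1.1] [cite: VoisinHodgeII2003, §4.3.1 Thm. 4.18] [cite: HatcherAT2002, §3.3 Prop. 3.38]
[cite: FultonYoungTableaux1997, Appendix B §B.1 (5)–(6)] -/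
theorem finrank_range_map_fiberι_eq_of_add (hS : IsSmoothProjective m S) (hf : IsSmoothProjectiveFamily f n)
    (h𝒳 : IsSmoothProjective N 𝒳) {a a' : ℕ} (haa : a + a' = 2 * n) (t : ComplexPoints S) :
    Module.finrank ℂ (LinearMap.range (complexBetti.map (fiberι f t) a).hom) =
      Module.finrank ℂ (LinearMap.range (complexBetti.map (fiberι f t) a').hom) := by
  obtain rfl : N = n + m := dim_total_eq_add hS hf h𝒳
  have hY := hf.isSmoothProjective t
  haveI : Module.Finite ℂ (complexBetti 𝒳 a) := finite_complexBetti h𝒳 _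
  haveI : Module.Finite ℂ (complexBetti 𝒳 a') := finite_complexBetti h𝒳 _
  letI := h𝒳.chartedSpace
  haveI := ComplexPoints.compactSpace_of_isSmoothProjective h𝒳
  haveI := ComplexPoints.t2Space_of_isSmoothProjective h𝒳
  have ha'a : a' + a = 2 * n := by omega
  have hbA : a' + 2 * (n + m) = (a' + 2 * m) + 2 * n := by ring
  have hbW : a + 2 * (n + m) = (a + 2 * m) + 2 * n := by ring
  have hbAa : (a' + 2 * m) + a = 2 * (n + m) := by omega
  have hbWa : (a + 2 * m) + a' = 2 * (n + m) := by omega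
  set j₁ : complexBetti 𝒳 a →ₗ[ℂ] complexBetti (fiberOver f t) a := (complexBetti.map (fiberι f t) a).hom with hj₁
  set j₂ : complexBetti 𝒳 a' →ₗ[ℂ] complexBetti (fiberOver f t) a' := (complexBetti.map (fiberι f t) a').hom with hj₂
  -- the pairing `B A W := ⟨j_t^* W ∪ j_t^* A, [X_t(ℂ)]⟩`
  set B : complexBetti 𝒳 a' →ₗ[ℂ] complexBetti 𝒳 a →ₗ[ℂ] ℂ :=
    ((cupPairing (complexOrientationFamily hY) haa).compl₁₂ j₁ j₂).flip with hB
  have hBapply : ∀ A W, B A W = cupPairing (complexOrientationFamily hY) haa (j₁ W) (j₂ A) := fun _ _ ↦ rfl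
  -- graded symmetry `⟨x ∪ y, [X_t]⟩ = ± ⟨y ∪ x, [X_t]⟩`
  have hBsymm : ∀ A W, B A W =
      ((-1 : ℂ) ^ (a * a')) • cupPairing (complexOrientationFamily hY) ha'a (j₂ A) (j₁ W) := fun A W ↦ by
    rw [hBapply, cupPairing_apply, cupPairing_apply, cupProduct_gradedComm_holds ℂ _ haa ha'a (j₁ W) (j₂ A), map_smul,
      LinearMap.smul_apply]
  have hsign : ((-1 : ℂ) ^ (a * a')) ≠ 0 := pow_ne_zero _ (neg_ne_zero.2 one_ne_zero)
  -- transposition `⟨j_{t*} x ∪ z, [𝒳]⟩ = ⟨x ∪ j_t^* z, [X_t]⟩`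
  have hadjA : ∀ A W, cupPairing (complexOrientationFamily h𝒳) hbAa
      (complexGysin complexOrientationFamily hY h𝒳 (fiberι f t) hbA (j₂ A)) W =
      cupPairing (complexOrientationFamily hY) ha'a (j₂ A) (j₁ W) := fun A W ↦
    cupPairing_complexGysin_complexOrientationFamily (fiberι f t) h𝒳 hY hbA ha'a hbAa (j₂ A) W
  have hadjW : ∀ A W, cupPairing (complexOrientationFamily h𝒳) hbWa
      (complexGysin complexOrientationFamily hY h𝒳 (fiberι f t) hbW (j₁ W)) A =
      cupPairing (complexOrientationFamily hY) haa (j₁ W) (j₂ A) := fun A W ↦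
    cupPairing_complexGysin_complexOrientationFamily (fiberι f t) h𝒳 hY hbW haa hbWa (j₁ W) A
  have hB₁ : ∀ A, j₂ A = 0 → ∀ W, B A W = 0 := fun A hA W ↦ by
    rw [hBapply, hA, map_zero]
  have hB₂ : ∀ W, j₁ W = 0 → ∀ A, B A W = 0 := fun W hW A ↦ by
    rw [hBapply, hW, map_zero, LinearMap.zero_apply]
  have hB₃ : ∀ A, (∀ W, B A W = 0) → j₂ A = 0 := fun A hA ↦ by
    -- `j_{t*}(j_t^* A) = 0` by Poincaré duality on `𝒳(ℂ)`, then Deligne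
    have h0 : complexGysin complexOrientationFamily hY h𝒳 (fiberι f t) hbA (j₂ A) = 0 := by
      have hPerf : (cupPairing (complexOrientationFamily h𝒳) hbAa).IsPerfPair := isPerfPair_cupPairing_of_field_holds
      refine (LinearMap.IsPerfPair.bijective_left (cupPairing (complexOrientationFamily h𝒳) hbAa)).1 ?_
      rw [map_zero]
      ext W
      rw [LinearMap.zero_apply, hadjA A W]
      have h := hA W
      rw [hBsymm A W] at h
      exact (smul_eq_zero.1 h).resolve_left hsign
    exact deligne1971_fibreGysin_injOn_restricted_holds f hS hf h𝒳 hbA t A h0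
  have hB₄ : ∀ W, (∀ A, B A W = 0) → j₁ W = 0 := fun W hW ↦ by
    have h0 : complexGysin complexOrientationFamily hY h𝒳 (fiberι f t) hbW (j₁ W) = 0 := by
      have hPerf : (cupPairing (complexOrientationFamily h𝒳) hbWa).IsPerfPair := isPerfPair_cupPairing_of_field_holds
      refine (LinearMap.IsPerfPair.bijective_left (cupPairing (complexOrientationFamily h𝒳) hbWa)).1 ?_
      rw [map_zero]
      ext A
      rw [LinearMap.zero_apply, hadjW A W, ← hBapply]
      exact hW A
    exact deligne1971_fibreGysin_injOn_restricted_holds f hS hf h𝒳 hbW t W h0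
  exact finrank_range_eq_of_perfect j₁ j₂ B hB₁ hB₂ hB₃ hB₄

/-- **`rank j_{t*}|Hᵃ(X_t) ≤ dim j_t^* H^{a'}(𝒳)` for `a + a' = 2n`**: the functional `z ↦ ⟨j_{t*} x ∪ z, [𝒳(ℂ)]⟩ = ⟨x ∪ j_t^* z, [X_t(ℂ)]⟩`
determines `j_{t*} x` (Poincaré duality on `𝒳(ℂ)`) and factors through `j_t^*`; §1.
[cite: FultonYoungTableaux1997, Appendix B §B.1 (5)–(6)] [cite: HatcherAT2002, §3.3 Prop. 3.38] -/
theorem finrank_range_complexGysin_fiberι_le (hS : IsSmoothProjective m S) (hf : IsSmoothProjectiveFamily f n)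
    (h𝒳 : IsSmoothProjective N 𝒳) {a b a' : ℕ} (hab : a + 2 * N = b + 2 * n) (haa : a + a' = 2 * n)
    (t : ComplexPoints S) :
    Module.finrank ℂ (LinearMap.range
        (complexGysin complexOrientationFamily (hf.isSmoothProjective t) h𝒳 (fiberι f t) hab)) ≤
      Module.finrank ℂ (LinearMap.range (complexBetti.map (fiberι f t) a').hom) := by
  obtain rfl : N = n + m := dim_total_eq_add hS hf h𝒳
  have hY := hf.isSmoothProjective t
  haveI : Module.Finite ℂ (complexBetti (fiberOver f t) a) := finite_complexBetti hY _
  haveI : Module.Finite ℂ (complexBetti 𝒳 a') := finite_complexBetti h𝒳 _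
  letI := h𝒳.chartedSpace
  haveI := ComplexPoints.compactSpace_of_isSmoothProjective h𝒳
  haveI := ComplexPoints.t2Space_of_isSmoothProjective h𝒳
  have hba' : b + a' = 2 * (n + m) := by omega
  set j₁ := complexGysin complexOrientationFamily hY h𝒳 (fiberι f t) hab with hj₁
  set j₂ : complexBetti 𝒳 a' →ₗ[ℂ] complexBetti (fiberOver f t) a' := (complexBetti.map (fiberι f t) a').hom with hj₂
  -- the pairing `B A x := ⟨x ∪ j_t^* A, [X_t(ℂ)]⟩`
  set B : complexBetti 𝒳 a' →ₗ[ℂ] complexBetti (fiberOver f t) a →ₗ[ℂ] ℂ :=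
    ((cupPairing (complexOrientationFamily hY) haa).compl₂ j₂).flip with hB
  have hBapply : ∀ A x, B A x = cupPairing (complexOrientationFamily hY) haa x (j₂ A) := fun _ _ ↦ rfl
  have hB₁ : ∀ A, j₂ A = 0 → ∀ x, B A x = 0 := fun A hA x ↦ by rw [hBapply, hA, map_zero]
  have hB₄ : ∀ x, (∀ A, B A x = 0) → j₁ x = 0 := fun x hx ↦ by
    have hPerf : (cupPairing (complexOrientationFamily h𝒳) hba').IsPerfPair := isPerfPair_cupPairing_of_field_holds
    refine (LinearMap.IsPerfPair.bijective_left (cupPairing (complexOrientationFamily h𝒳) hba')).1 ?_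
    rw [map_zero]
    ext A
    rw [LinearMap.zero_apply, hj₁, cupPairing_complexGysin_complexOrientationFamily (fiberι f t) h𝒳 hY hab haa hba' x A,
      ← hBapply]
    exact hx A
  exact finrank_range_le_of_pairing j₁ j₂ B hB₁ hB₄

/-- `j_{t*}` is injective on `Im j_t^*` (Deligne's `ker j_{t*} ∩ Im j_t^* = 0`, part XII-e), as an injective composite.
[cite: VoisinHodgeII2003, §4.3.1 Thm. 4.18] [cite: DeligneHodgeII1971, Thm. 4.1.1 and Thm. 4.2.6] -/
theorem injective_complexGysin_comp_subtype_range (hS : IsSmoothProjective m S) (hf : IsSmoothProjectiveFamily f n)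
    (h𝒳 : IsSmoothProjective N 𝒳) {a b : ℕ} (hab : a + 2 * N = b + 2 * n) (t : ComplexPoints S) :
    Function.Injective (complexGysin complexOrientationFamily (hf.isSmoothProjective t) h𝒳 (fiberι f t) hab ∘ₗ
      (LinearMap.range (complexBetti.map (fiberι f t) a).hom).subtype) := by
  rw [← LinearMap.ker_eq_bot, Submodule.eq_bot_iff]
  rintro ⟨v, ⟨W, rfl⟩⟩ hv
  rw [LinearMap.mem_ker, LinearMap.comp_apply, Submodule.subtype_apply] at hv
  exact Subtype.ext (deligne1971_fibreGysin_injOn_restricted_holds f hS hf h𝒳 hab t W hv)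

/-- **(surjInv) AS A THEOREM: `range j_{t*} = j_{t*}(Im j_t^*)`** — every Gysin image of a class of the smooth fibre `X_t` is the
Gysin image of the restriction of a global class (an invariant class), for every smooth projective family over a smooth projective
base, in every degree (`⊇` trivially; the dimensions agree: `dim j_{t*}(Im j_t^*|ₐ) = dim Im j_t^*|ₐ = dim Im j_t^*|_{2n−a} ≥ rank j_{t*}`;
above degree `2n` both sides vanish). In print: `j_{t*}` kills the variant part of `Hᵃ(X_t) = Hᵃ(X_t)^π ⊕ (variant)` (Deligne).
[cite: DeligneHodgeII1971, Thm. 4.1.1 and Cor. 4.2.8] [cite: VoisinHodgeII2003, §4.3.3 Thm. 4.24] -/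
theorem range_complexGysin_fiberι_eq_map_range (hS : IsSmoothProjective m S) (hf : IsSmoothProjectiveFamily f n)
    (h𝒳 : IsSmoothProjective N 𝒳) {a b : ℕ} (hab : a + 2 * N = b + 2 * n) (t : ComplexPoints S) :
    LinearMap.range (complexGysin complexOrientationFamily (hf.isSmoothProjective t) h𝒳 (fiberι f t) hab) =
      (LinearMap.range (complexBetti.map (fiberι f t) a).hom).map
        (complexGysin complexOrientationFamily (hf.isSmoothProjective t) h𝒳 (fiberι f t) hab) := by
  have hY := hf.isSmoothProjective t
  by_cases ha : a ≤ 2 * n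
  swap
  · rw [complexGysin_of_lt hY h𝒳 (fiberι f t) hab (not_le.1 ha), LinearMap.range_zero, Submodule.map_zero]
  obtain ⟨a', haa⟩ : ∃ a', a + a' = 2 * n := ⟨2 * n - a, by omega⟩
  haveI : Module.Finite ℂ (complexBetti (fiberOver f t) a) := finite_complexBetti hY _
  haveI : Module.Finite ℂ (complexBetti 𝒳 a) := finite_complexBetti h𝒳 _
  haveI : Module.Finite ℂ (complexBetti 𝒳 b) := finite_complexBetti h𝒳 _
  set g := complexGysin complexOrientationFamily hY h𝒳 (fiberι f t) hab with hg
  set V := LinearMap.range (complexBetti.map (fiberι f t) a).hom with hV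
  have hle : V.map g ≤ LinearMap.range g := LinearMap.map_le_range
  have hVg : Module.finrank ℂ (V.map g) = Module.finrank ℂ V := by
    rw [show V.map g = LinearMap.range (g ∘ₗ V.subtype) by rw [LinearMap.range_comp, Submodule.range_subtype]]
    exact LinearMap.finrank_range_of_inj (injective_complexGysin_comp_subtype_range hS hf h𝒳 hab t)
  refine (Submodule.eq_of_le_of_finrank_eq hle (le_antisymm (Submodule.finrank_mono hle) ?_)).symm
  calc Module.finrank ℂ (LinearMap.range g)
      ≤ Module.finrank ℂ (LinearMap.range (complexBetti.map (fiberι f t) a').hom) :=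
        finrank_range_complexGysin_fiberι_le hS hf h𝒳 hab haa t
    _ = Module.finrank ℂ V := (finrank_range_map_fiberι_eq_of_add hS hf h𝒳 haa t).symm
    _ = Module.finrank ℂ (V.map g) := hVg.symm

/-- **(surjInv), the `∃` form displayed in part XXV-f's `CMThetaInv[]`**: for every `x ∈ Hᵃ(X_t(ℂ); ℂ)` there is a global
`y ∈ Hᵃ(𝒳(ℂ); ℂ)` with `j_{t*} x = j_{t*}(j_t^* y)`. [cite: DeligneHodgeII1971, Thm. 4.1.1 and Cor. 4.2.8]
[cite: VoisinHodgeII2003, §4.3.3 Thm. 4.24] -/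
theorem exists_complexGysin_fiberι_eq_complexGysin_map (hS : IsSmoothProjective m S) (hf : IsSmoothProjectiveFamily f n)
    (h𝒳 : IsSmoothProjective N 𝒳) {a b : ℕ} (hab : a + 2 * N = b + 2 * n) (t : ComplexPoints S)
    (x : complexBetti (fiberOver f t) a) :
    ∃ y : complexBetti 𝒳 a,
      complexGysin complexOrientationFamily (hf.isSmoothProjective t) h𝒳 (fiberι f t) hab x =
        complexGysin complexOrientationFamily (hf.isSmoothProjective t) h𝒳 (fiberι f t) hab
          (complexBetti.map (fiberι f t) a y) := by
  have hx : complexGysin complexOrientationFamily (hf.isSmoothProjective t) h𝒳 (fiberι f t) hab x ∈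
      (LinearMap.range (complexBetti.map (fiberι f t) a).hom).map
        (complexGysin complexOrientationFamily (hf.isSmoothProjective t) h𝒳 (fiberι f t) hab) := by
    rw [← range_complexGysin_fiberι_eq_map_range hS hf h𝒳 hab t]
    exact LinearMap.mem_range_self _ x
  obtain ⟨v, ⟨y, rfl⟩, hv⟩ := hx
  exact ⟨y, hv.symm⟩

/-- **`rank j_{t*}|Hᵃ(X_t) = dim j_t^* Hᵃ(𝒳)`.** [cite: DeligneHodgeII1971, Thm. 4.1.1 and Cor. 4.2.8] [cite: VoisinHodgeII2003, §4.3.3 Thm. 4.24] -/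
theorem finrank_range_complexGysin_fiberι_eq (hS : IsSmoothProjective m S) (hf : IsSmoothProjectiveFamily f n)
    (h𝒳 : IsSmoothProjective N 𝒳) {a b : ℕ} (hab : a + 2 * N = b + 2 * n) (t : ComplexPoints S) :
    Module.finrank ℂ (LinearMap.range
        (complexGysin complexOrientationFamily (hf.isSmoothProjective t) h𝒳 (fiberι f t) hab)) =
      Module.finrank ℂ (LinearMap.range (complexBetti.map (fiberι f t) a).hom) := by
  rw [range_complexGysin_fiberι_eq_map_range hS hf h𝒳 hab t,
    show (LinearMap.range (complexBetti.map (fiberι f t) a).hom).map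
        (complexGysin complexOrientationFamily (hf.isSmoothProjective t) h𝒳 (fiberι f t) hab) =
      LinearMap.range (complexGysin complexOrientationFamily (hf.isSmoothProjective t) h𝒳 (fiberι f t) hab ∘ₗ
        (LinearMap.range (complexBetti.map (fiberι f t) a).hom).subtype) by
      rw [LinearMap.range_comp, Submodule.range_subtype]]
  exact LinearMap.finrank_range_of_inj (injective_complexGysin_comp_subtype_range hS hf h𝒳 hab t)

/-- **`Hᵃ(X_t(ℂ); ℂ) = j_t^* Hᵃ(𝒳(ℂ); ℂ) ⊕ ker j_{t*}`** — the invariant / co-vanishing decomposition of the cohomology of a fibre of a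
smooth projective family over a smooth projective base (no singular fibres): the two subspaces meet in `0` (Deligne) and their
dimensions add up to `dim Hᵃ(X_t)` (`rank j_{t*} = dim Im j_t^*`). [cite: DeligneHodgeII1971, Thm. 4.1.1 and Cor. 4.2.8]
[cite: VoisinHodgeII2003, §4.3.1 Thm. 4.18 and §4.3.3 Thm. 4.24] -/
theorem isCompl_range_map_fiberι_ker_complexGysin (hS : IsSmoothProjective m S) (hf : IsSmoothProjectiveFamily f n)
    (h𝒳 : IsSmoothProjective N 𝒳) {a b : ℕ} (hab : a + 2 * N = b + 2 * n) (t : ComplexPoints S) :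
    IsCompl (LinearMap.range (complexBetti.map (fiberι f t) a).hom)
      (LinearMap.ker (complexGysin complexOrientationFamily (hf.isSmoothProjective t) h𝒳 (fiberι f t) hab)) := by
  have hY := hf.isSmoothProjective t
  haveI : Module.Finite ℂ (complexBetti (fiberOver f t) a) := finite_complexBetti hY _
  set g := complexGysin complexOrientationFamily hY h𝒳 (fiberι f t) hab with hg
  set V := LinearMap.range (complexBetti.map (fiberι f t) a).hom with hV
  have hdisj : Disjoint V (LinearMap.ker g) := by
    rw [Submodule.disjoint_def]
    rintro _ ⟨W, rfl⟩ hW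
    exact deligne1971_fibreGysin_injOn_restricted_holds f hS hf h𝒳 hab t W (LinearMap.mem_ker.1 hW)
  have hinf : V ⊓ LinearMap.ker g = ⊥ := hdisj.eq_bot
  have hsum : Module.finrank ℂ V + Module.finrank ℂ (LinearMap.ker g) =
      Module.finrank ℂ (complexBetti (fiberOver f t) a) := by
    rw [← finrank_range_complexGysin_fiberι_eq hS hf h𝒳 hab t]
    exact LinearMap.finrank_range_add_finrank_ker g
  have hsup : V ⊔ LinearMap.ker g = ⊤ := by
    apply Submodule.eq_top_of_finrank_eq
    have h := Submodule.finrank_sup_add_finrank_inf_eq V (LinearMap.ker g)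
    rw [hinf, finrank_bot, add_zero] at h
    rw [h, hsum]
  exact ⟨hdisj, codisjoint_iff.2 hsup⟩

end Family

end Summit.HodgeConjecture.HodgeConjecture.Ring2.AbelianAll

end
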